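import Mathlib
import Literature.AlgebraicGeometry.Resolution.AugmentationIdeal
import Literature.AlgebraicGeometry.Resolution.AffineBlowupAlgebra
import Literature.AlgebraicGeometry.Resolution.OneDimensionalBlowupTowerLemmas
import Summits.ResolutionOfSingularities.ResolutionOfSingularities.Theorems.WildQuotientsWildQuotientResolutionInvolutionKLTwice
import Summits.ResolutionOfSingularities.ResolutionOfSingularities.Theorems.WildQuotientsWildQuotientResolutionInvolutionReesParity

/-!
# The chart dictionary `(R[I_ι/y])^ι = R₊[K/y²]` for an involution with `2` invertible (card `mu2-strata-kl-twice`)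

(crux stmt-ResolutionOfSingularities-15640 `WildQuotients.WildQuotientResolution`, line `Sketch`,
sector `|G| = p`; RUNG V5 of `L/w45c/CHAIN.md` v8.4, brick B7/`HP₂` (ε)/(δ) support;
res-L1-w45c-plan-1 ORDER 2026-08-27T13:09:50Z (o1) «the CHART DICTIONARY», in the abstract
invariant-ring presentation `(j : S →+* R)` injective with range the `ι`-fixed elements (the shape
of the chain's ring bricks `ψC`). [OURS · L1 W4.5c] — NOT a statement of any manuscript; replaces
the role of no printed item. Prover res-L1-w45c-stub-3.)

Setting: `R` a commutative ring, `ι : R ≃+* R` an involution with `2 ∈ Rˣ`, `I := augIdeal ι`;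
`j : S →+* R` injective with `range j = R₊ := {x | ι x = x}`; `K := I.comap j` (`= (I² = (R₋R₋))`
contracted, by `InvolutionExit.mem_augIdeal_iff_mem_sq_of_invariant`); `y ∈ R` anti-invariant
(`ι y = −y`), `t ∈ S` with `j t = y²`; `C := blowupAlgebra I y = R[I/y] ⊆ R[1/y]` (= res-type-036's
H4 carrier by `adjoin_ratio_eq_blowupAlgebra`) with ANY ring involution `ιC` of `C` over `ι`
(H4 `involutionChartTerminal` provides one).

* `sq_le_map_comap` — `I² ≤ K·R` (`I² = (ab : a, b ∈ R₋)` and `ab ∈ j(K)`), hence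
  `pow_two_mul_le_map_comap_pow` — `I^{2n} ≤ Kⁿ·R`;
* `exists_eq_add_apply_of_mem_map` — for an ideal `K'` of `S`, `z ∈ K'·R` and any `r`,
  `r z + ι(r z) ∈ j(K')`; so an INVARIANT element of `I^{2n}` is `j κ` with `κ ∈ Kⁿ`
  (`exists_eq_of_mem_pow_of_invariant`);
* **`exists_chartRingHom`** — THE DICTIONARY: there is an injective ring homomorphism
  `Φ : S[K/t] →+* R[I/y]` (`S[K/t] = blowupAlgebra K t`, the `y²`-chart of `Bl_K(Spec S)`) over `j`
  (`Φ (s/1) = j s /1`, `Φ (κ/t) = jκ/y²`) whose RANGE IS EXACTLY THE `ιC`-FIXED SUBRING of `R[I/y]`: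
  `∀ c, c ∈ Φ.range ↔ ιC c = c`. With H4 (principal augmentation of `ιC`), H5 (K–L at the prime 2)
  and `isRegularRing_involutionChart` ((2)+(3)), every `y²`-chart of `Bl_K(Spec R₊)` is a regular
  ring — the input of 036's (ε) `Scheme.IsRegular (affineBlowup K)`; `exists_chartRingEquiv` — the
  same as a `RingEquiv` onto ANY subring `F ⊆ C` that is exactly the `ιC`-fixed locus.
-/

-- single-problem summit: the doubled namespace component `ResolutionOfSingularities` is forced
set_option linter.dupNamespace false

noncomputable section

namespace Summit.ResolutionOfSingularities.ResolutionOfSingularities.Theorems.WildQuotientResolution.InvolutionExit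

open IsLocalization Literature.AlgebraicGeometry.Resolution

variable {R S : Type} [CommRing R] [CommRing S] (ι : R ≃+* R) (hι : ∀ x, ι (ι x) = x)
  (j : S →+* R) (hj : Function.Injective j) (hfix : ∀ x : R, x ∈ j.range ↔ ι x = x)

include hfix in
/-- An invariant element is in the image of `j`. [folklore] -/
theorem exists_eq_of_invariant {x : R} (hx : ι x = x) : ∃ s : S, j s = x :=
  RingHom.mem_range.mp ((hfix x).mpr hx)

include hfix in
/-- Elements of the image of `j` are invariant. [folklore] -/
theorem apply_map_eq (s : S) : ι (j s) = j s := (hfix (j s)).mp ⟨s, rfl⟩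

include hι hfix in
/-- `I_ι² ≤ K · R` for `K = I_ι.comap j` (`2` invertible): the square of the augmentation ideal is
generated by products of two anti-invariants, which are invariant elements of `I_ι`.
[OURS · L1 W4.5c] [folklore] -/
theorem sq_le_map_comap (h2 : IsUnit (2 : R)) :
    augIdeal ι ^ 2 ≤ ((augIdeal ι).comap j).map j := by
  rw [← span_anti_mul_anti_eq_sq ι hι h2]
  refine Ideal.span_le.mpr ?_
  rintro _ ⟨a, b, ha, hb, rfl⟩
  have hinv : ι (a * b) = a * b := by rw [map_mul, ha, hb]; ring
  obtain ⟨s, hs⟩ := exists_eq_of_invariant ι j hfix hinv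
  have hsK : s ∈ (augIdeal ι).comap j := by
    rw [Ideal.mem_comap, hs]
    have : a * b ∈ augIdeal ι ^ 2 := by
      rw [pow_two]
      exact Ideal.mul_mem_mul (mem_augIdeal_of_anti ι hι h2 ha) (mem_augIdeal_of_anti ι hι h2 hb)
    exact Ideal.pow_le_self two_ne_zero this
  rw [SetLike.mem_coe, ← hs]
  exact Ideal.mem_map_of_mem j hsK

include hι hfix in
/-- `I_ι^{2n} ≤ Kⁿ · R`. [OURS · L1 W4.5c] [folklore] -/
theorem pow_two_mul_le_map_comap_pow (h2 : IsUnit (2 : R)) (n : ℕ) :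
    augIdeal ι ^ (2 * n) ≤ (((augIdeal ι).comap j) ^ n).map j := by
  rw [pow_mul, Ideal.map_pow]
  exact Ideal.pow_right_mono (sq_le_map_comap ι hι j hfix h2) n

include hι hfix in
/-- **Averaging into the invariant image**: for an ideal `K'` of `S`, `z ∈ K'·R` and any `r ∈ R`,
`r z + ι (r z) = j κ` for some `κ ∈ K'`. [OURS · L1 W4.5c] [folklore] -/
theorem exists_eq_add_apply_of_mem_map {K' : Ideal S} {z : R} (hz : z ∈ K'.map j) :
    ∀ r : R, ∃ κ ∈ K', j κ = r * z + ι (r * z) := by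
  rw [Ideal.map] at hz
  induction hz using Submodule.span_induction with
  | mem x hx =>
    obtain ⟨κ₀, hκ₀, rfl⟩ := hx
    intro r
    have hinv : ι (r + ι r) = r + ι r := by rw [map_add, hι r]; ring
    obtain ⟨s, hs⟩ := exists_eq_of_invariant ι j hfix hinv
    refine ⟨s * κ₀, Ideal.mul_mem_left _ _ hκ₀, ?_⟩
    rw [map_mul, hs, map_mul, apply_map_eq ι j hfix κ₀]
    ring
  | zero => intro r; exact ⟨0, zero_mem _, by simp⟩
  | add x z _ _ hx hz =>
    intro r
    obtain ⟨κ₁, hκ₁, e₁⟩ := hx r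
    obtain ⟨κ₂, hκ₂, e₂⟩ := hz r
    refine ⟨κ₁ + κ₂, add_mem hκ₁ hκ₂, ?_⟩
    rw [map_add, e₁, e₂, mul_add, map_add]
    ring
  | smul a x _ hx =>
    intro r
    obtain ⟨κ, hκ, e⟩ := hx (r * a)
    refine ⟨κ, hκ, ?_⟩
    rw [e, smul_eq_mul, mul_assoc]

include hι hfix in
/-- **Invariant elements of `I_ι^{2n}` come from `Kⁿ`**: if `ι z = z` and `z ∈ I_ι^{2n}` then
`z = j κ` with `κ ∈ Kⁿ` (`2` invertible). [OURS · L1 W4.5c] [folklore] -/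
theorem exists_eq_of_mem_pow_of_invariant (h2 : IsUnit (2 : R)) {n : ℕ} {z : R}
    (hz : z ∈ augIdeal ι ^ (2 * n)) (hzι : ι z = z) :
    ∃ κ ∈ ((augIdeal ι).comap j) ^ n, j κ = z := by
  obtain ⟨u, hu⟩ := h2.exists_left_inv
  obtain ⟨κ, hκ, e⟩ := exists_eq_add_apply_of_mem_map ι hι j hfix
    (pow_two_mul_le_map_comap_pow ι hι j hfix h2 n hz) u
  refine ⟨κ, hκ, ?_⟩
  rw [e, map_mul, hzι, ← add_mul]
  have hιu : ι u = u := by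
    -- `u = ⅟2` is fixed: `ι u * 2 = ι (u * 2) = 1`
    have h1 : ι u * 2 = 1 := by
      have := congrArg ι hu
      rwa [map_mul, map_ofNat, map_one] at this
    calc ι u = ι u * (2 * u) := by rw [mul_comm 2 u, hu, mul_one]
      _ = (ι u * 2) * u := by ring
      _ = u := by rw [h1, one_mul]
  rw [hιu, ← two_mul, mul_comm (2 : R) u, hu, one_mul]

omit [CommRing S] in
/-- `ι` preserves the powers of its augmentation ideal. [folklore] -/
theorem apply_mem_pow_augIdeal {k : ℕ} {x : R} (hx : x ∈ augIdeal ι ^ k) : ι x ∈ augIdeal ι ^ k := by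
  have h1 : (augIdeal ι ^ k).map (ι : R →+* R) ≤ augIdeal ι ^ k := by
    rw [Ideal.map_pow]
    refine Ideal.pow_right_mono ?_ k
    rw [Ideal.map_le_iff_le_comap]
    intro z hz
    exact apply_mem_augIdeal_of_mem ι hz
  exact h1 (Ideal.mem_map_of_mem _ hx)

omit [CommRing S] in
/-- `½` is `ι`-invariant. [folklore] -/
theorem apply_eq_self_of_mul_two {u : R} (hu : u * 2 = 1) : ι u = u := by
  have h1 : ι u * 2 = 1 := by
    have := congrArg ι hu
    rwa [map_mul, map_ofNat, map_one] at this
  calc ι u = ι u * (2 * u) := by rw [mul_comm 2 u, hu, mul_one]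
    _ = (ι u * 2) * u := by ring
    _ = u := by rw [h1, one_mul]

include hι hj hfix in
/-- **The chart dictionary `(R[I_ι/y])^{ι} = S[K/t]`** (`j : S ↪ R` the invariants, `K = I_ι.comap j`,
`y` anti-invariant, `j t = y²`, `2 ∈ Rˣ`): for the chart ring `C = R[I_ι/y]` of `Bl_{I_ι}(Spec R)` at
`y` (in any spelling `C = blowupAlgebra (augIdeal ι) y`) and any ring involution `ιC` of `C` over `ι`,
there is an INJECTIVE ring homomorphism `Φ : S[K/t] →+* C` over `j` whose range is exactly the
`ιC`-fixed subring. [OURS · L1 W4.5c, card `mu2-strata-kl-twice` (o1)] [folklore] -/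
theorem exists_chartRingHom (h2 : IsUnit (2 : R)) {y : R} (hy : ι y = -y) (t : S)
    (ht : j t = y ^ 2) (C : Subalgebra R (Localization.Away y))
    (hC : C = blowupAlgebra (augIdeal ι) y) (ιC : C ≃+* C)
    (hιC : ∀ r : R, ((ιC (algebraMap R C r) : C) : Localization.Away y) =
      algebraMap R (Localization.Away y) (ι r)) :
    ∃ Φ : blowupAlgebra ((augIdeal ι).comap j) t →+* C,
      Function.Injective Φ ∧
      (∀ s : S, ((Φ (algebraMap S (blowupAlgebra ((augIdeal ι).comap j) t) s) : C) :
          Localization.Away y) = algebraMap R (Localization.Away y) (j s)) ∧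
      (∀ c : C, c ∈ Φ.range ↔ ιC c = c) := by
  classical
  subst hC
  obtain ⟨u, hu⟩ := h2.exists_left_inv
  have hιu : ι u = u := apply_eq_self_of_mul_two ι hu
  have hyI : y ∈ augIdeal ι := mem_augIdeal_of_anti ι hι h2 hy
  obtain ⟨uy, huy⟩ := IsLocalization.Away.algebraMap_isUnit (S := Localization.Away y) y
  -- the extension `ι'` of `ι` to `R[1/y]`, and `ιC = ι'` on `R[I/y]`
  set ι' : Localization.Away y →+* Localization.Away y :=
    IsLocalization.Away.lift (S := Localization.Away y) y (isUnit_algebraMap_comp_apply ι y hy)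
    with hι'
  have hι'alg : ∀ r : R, ι' (algebraMap R (Localization.Away y) r) =
      algebraMap R (Localization.Away y) (ι r) := fun r => by
    rw [hι', IsLocalization.Away.lift_eq, RingHom.comp_apply, RingHom.coe_coe]
  -- `ιC` and `ι'` agree on every `q ∈ R[I/y]` with `q · y ∈ R` (cancel the unit `-y`)
  have hgen : ∀ (q : blowupAlgebra (augIdeal ι) y) (b : R),
      (q : Localization.Away y) * algebraMap R (Localization.Away y) y =
        algebraMap R (Localization.Away y) b →
      ((ιC q : blowupAlgebra (augIdeal ι) y) : Localization.Away y) = ι' q := by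
    intro q b hqb
    have hq' : q * algebraMap R (blowupAlgebra (augIdeal ι) y) y =
        algebraMap R (blowupAlgebra (augIdeal ι) y) b := Subtype.ext hqb
    have h1 := congrArg
      (fun c : blowupAlgebra (augIdeal ι) y => ((ιC c : blowupAlgebra (augIdeal ι) y) :
        Localization.Away y)) hq'
    simp only [map_mul, Subalgebra.coe_mul, hιC] at h1
    rw [hy, map_neg, ← huy] at h1
    have h3 : ι' (q : Localization.Away y) * -↑uy = algebraMap R (Localization.Away y) (ι b) := by
      have := congrArg ι' hqb
      rw [map_mul, hι'alg, hι'alg, hy, map_neg, ← huy] at this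
      exact this
    exact (uy.isUnit.neg).mul_left_injective (h1.trans h3.symm)
  have hιC' : ∀ c : blowupAlgebra (augIdeal ι) y,
      ((ιC c : blowupAlgebra (augIdeal ι) y) : Localization.Away y) = ι' c := by
    intro c
    obtain ⟨x, hx⟩ := c
    induction hx using Algebra.adjoin_induction with
    | mem q hq =>
      obtain ⟨b, hb, rfl⟩ := hq
      refine hgen _ b ?_
      change algebraMap R (Localization.Away y) b * Away.invSelf y *
        algebraMap R (Localization.Away y) y = algebraMap R (Localization.Away y) b
      rw [mul_assoc, mul_comm (Away.invSelf y), Away.mul_invSelf, mul_one]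
    | algebraMap r =>
      refine hgen _ (r * y) ?_
      change algebraMap R (Localization.Away y) r * algebraMap R (Localization.Away y) y = _
      rw [map_mul]
    | add x z hx hz ihx ihz =>
      have : (⟨x + z, Subalgebra.add_mem _ hx hz⟩ : blowupAlgebra (augIdeal ι) y) =
          ⟨x, hx⟩ + ⟨z, hz⟩ := rfl
      rw [this, map_add, Subalgebra.coe_add, ihx, ihz, Subalgebra.coe_add, map_add]
    | mul x z hx hz ihx ihz =>
      have : (⟨x * z, Subalgebra.mul_mem _ hx hz⟩ : blowupAlgebra (augIdeal ι) y) =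
          ⟨x, hx⟩ * ⟨z, hz⟩ := rfl
      rw [this, map_mul, Subalgebra.coe_mul, ihx, ihz, Subalgebra.coe_mul, map_mul]
  -- the map `Φ₀ : S[1/t] → R[1/y]` over `j`
  have hunit : IsUnit (((algebraMap R (Localization.Away y)).comp j) t) := by
    rw [RingHom.comp_apply, ht, map_pow]
    exact (IsLocalization.Away.algebraMap_isUnit (S := Localization.Away y) y).pow 2
  set Φ₀ : Localization.Away t →+* Localization.Away y :=
    IsLocalization.Away.lift (S := Localization.Away t) t hunit with hΦ₀
  have hΦ₀alg : ∀ s : S, Φ₀ (algebraMap S (Localization.Away t) s) =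
      algebraMap R (Localization.Away y) (j s) := fun s => by
    rw [hΦ₀, IsLocalization.Away.lift_eq, RingHom.comp_apply]
  have hΦ₀inv : Φ₀ (Away.invSelf t) = Away.invSelf y ^ 2 := by
    have h1 : Φ₀ (Away.invSelf t) * algebraMap R (Localization.Away y) (y ^ 2) = 1 := by
      rw [← ht, ← hΦ₀alg, ← map_mul, mul_comm, Away.mul_invSelf, map_one]
    have h2' : Away.invSelf y ^ 2 * algebraMap R (Localization.Away y) (y ^ 2) = 1 := by
      rw [map_pow, ← mul_pow, mul_comm, Away.mul_invSelf, one_pow]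
    have hu2 : IsUnit (algebraMap R (Localization.Away y) (y ^ 2)) := by
      rw [map_pow]
      exact (IsLocalization.Away.algebraMap_isUnit (S := Localization.Away y) y).pow 2
    exact hu2.mul_left_injective (h1.trans h2'.symm)
  -- `Φ₀` maps `S[K/t]` into `R[I/y]`: `κ/t ↦ jκ/y²` with `jκ ∈ I ∩ R₊ = I² ∩ R₊`
  have hmaps : ∀ z ∈ blowupAlgebra ((augIdeal ι).comap j) t,
      Φ₀ z ∈ blowupAlgebra (augIdeal ι) y := by
    intro z hz
    induction hz using Algebra.adjoin_induction with
    | mem q hq =>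
      obtain ⟨κ, hκ, rfl⟩ := hq
      rw [map_mul, hΦ₀alg, hΦ₀inv]
      have hκI : j κ ∈ augIdeal ι := hκ
      have hκ2 : j κ ∈ augIdeal ι ^ 2 := by
        have h := mem_pow_iff_mem_pow_two_mul_of_invariant ι hι h2 1 (j κ) (apply_map_eq ι j hfix κ)
        rw [pow_one] at h
        exact h.mp hκI
      exact algebraMap_mul_invSelf_pow_mem_blowupAlgebra y 2 hκ2
    | algebraMap s => rw [hΦ₀alg]; exact Subalgebra.algebraMap_mem _ _
    | add x z _ _ hx hz => rw [map_add]; exact add_mem hx hz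
    | mul x z _ _ hx hz => rw [map_mul]; exact mul_mem hx hz
  set Φ : blowupAlgebra ((augIdeal ι).comap j) t →+* blowupAlgebra (augIdeal ι) y :=
    Φ₀.restrict (blowupAlgebra ((augIdeal ι).comap j) t) (blowupAlgebra (augIdeal ι) y) hmaps
    with hΦ
  have hΦval : ∀ z : blowupAlgebra ((augIdeal ι).comap j) t,
      ((Φ z : blowupAlgebra (augIdeal ι) y) : Localization.Away y) = Φ₀ z := fun z => rfl
  -- `Φ₀` is injective (`j` injective, `j t = y²`)
  have hΦ₀inj : ∀ z : Localization.Away t, Φ₀ z = 0 → z = 0 := by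
    intro z hz
    obtain ⟨⟨s, d⟩, hsd⟩ := IsLocalization.surj (Submonoid.powers t) z
    -- `hsd : z * (d/1) = s/1`
    have h1 : algebraMap R (Localization.Away y) (j s) = 0 := by
      rw [← hΦ₀alg, ← hsd, map_mul, hz, zero_mul]
    obtain ⟨⟨m, hm⟩, hm0⟩ :=
      (IsLocalization.map_eq_zero_iff (Submonoid.powers y) (Localization.Away y) (j s)).mp h1
    obtain ⟨k, rfl⟩ := (Submonoid.mem_powers_iff _ _).mp hm
    -- `y^k · j s = 0 ⇒ j (t^k s) = 0 ⇒ t^k s = 0 ⇒ s/1 = 0 ⇒ z = 0`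
    have h3 : j (t ^ k * s) = 0 := by
      rw [map_mul, map_pow, ht, ← pow_mul]
      have : y ^ (2 * k) * j s = y ^ k * (y ^ k * j s) := by ring
      rw [this]
      change (y ^ k) * j s = 0 at hm0
      rw [hm0, mul_zero]
    have h4 : t ^ k * s = 0 := hj (by rw [h3, map_zero])
    have h5 : algebraMap S (Localization.Away t) s = 0 := by
      have := congrArg (algebraMap S (Localization.Away t)) h4
      rw [map_mul, map_zero, map_pow] at this
      exact ((IsLocalization.Away.algebraMap_isUnit (S := Localization.Away t) t).pow k
        ).mul_right_eq_zero.mp this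
    rw [h5] at hsd
    exact (IsLocalization.map_units (Localization.Away t) d).mul_left_eq_zero.mp hsd
  refine ⟨Φ, ?_, ?_, ?_⟩
  · intro a b hab
    have h1 : Φ₀ ((a : Localization.Away t) - b) = 0 := by
      rw [map_sub, ← hΦval, ← hΦval, hab, sub_self]
    exact Subtype.ext (sub_eq_zero.mp (hΦ₀inj _ h1))
  · intro s
    rw [hΦval, Subalgebra.coe_algebraMap, hΦ₀alg]
  · intro c
    constructor
    · -- `Φ z` is `ιC`-fixed: `ι' ∘ Φ₀ = Φ₀`
      rintro ⟨z, rfl⟩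
      have hcomp : ι'.comp Φ₀ = Φ₀ := by
        refine IsLocalization.ringHom_ext (Submonoid.powers t) ?_
        ext s
        simp only [RingHom.comp_apply, hΦ₀alg, hι'alg, apply_map_eq ι j hfix s]
      apply Subtype.ext
      rw [hιC', hΦval]
      exact RingHom.congr_fun hcomp _
    · intro hc
      have hcfix : ι' (c : Localization.Away y) = c := by rw [← hιC', hc]
      obtain ⟨n, r, hr, hcr⟩ := exists_pow_mul_eq_of_mem_blowupAlgebra hyI c.2
      -- `r' = r yⁿ ∈ I^{2n}` with `y^{2n} c = r'`
      have hr' : r * y ^ n ∈ augIdeal ι ^ (2 * n) := by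
        rw [two_mul, pow_add]
        exact Ideal.mul_mem_mul hr (Ideal.pow_mem_pow hyI n)
      have hcr' : algebraMap R (Localization.Away y) (y ^ (2 * n)) * c =
          algebraMap R (Localization.Away y) (r * y ^ n) := by
        rw [two_mul, pow_add, map_mul, mul_assoc,
          mul_comm (algebraMap R (Localization.Away y) (y ^ n)) (c : Localization.Away y),
          ← mul_assoc, hcr, ← map_mul]
      -- symmetrise: `r'' = u (r' + ι r')` is invariant, in `I^{2n}`, with `y^{2n} c = r''`
      have hιr' : algebraMap R (Localization.Away y) (y ^ (2 * n)) * c =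
          algebraMap R (Localization.Away y) (ι (r * y ^ n)) := by
        have h1 := congrArg ι' hcr'
        rw [map_mul, hcfix, hι'alg, hι'alg, map_pow, hy, Even.neg_pow (even_two_mul n)] at h1
        exact h1
      set r'' := u * (r * y ^ n + ι (r * y ^ n)) with hr''
      have hr''mem : r'' ∈ augIdeal ι ^ (2 * n) :=
        Ideal.mul_mem_left _ _ (add_mem hr' (apply_mem_pow_augIdeal ι hr'))
      have hr''ι : ι r'' = r'' := by
        rw [hr'', map_mul, map_add, hι, hιu]; ring
      have hcr'' : algebraMap R (Localization.Away y) (y ^ (2 * n)) * c =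
          algebraMap R (Localization.Away y) r'' := by
        have e : (2 : R) * r'' = r * y ^ n + ι (r * y ^ n) := by
          rw [hr'', ← mul_assoc, mul_comm (2 : R) u, hu, one_mul]
        have e2 : (2 : Localization.Away y) * (algebraMap R (Localization.Away y) (y ^ (2 * n)) * c) =
            (2 : Localization.Away y) * algebraMap R (Localization.Away y) r'' := by
          rw [← map_ofNat (algebraMap R (Localization.Away y)) 2, ← map_mul, e, map_add, ← hcr',
            ← hιr', map_ofNat, two_mul]
        have h2L : IsUnit (2 : Localization.Away y) := by
          rw [← map_ofNat (algebraMap R (Localization.Away y)) 2]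
          exact h2.map _
        exact h2L.mul_right_injective e2
      obtain ⟨κ, hκ, hjκ⟩ := exists_eq_of_mem_pow_of_invariant ι hι j hfix h2 hr''mem hr''ι
      -- the preimage `κ / tⁿ`
      have hzmem : algebraMap S (Localization.Away t) κ * Away.invSelf t ^ n ∈
          blowupAlgebra ((augIdeal ι).comap j) t :=
        algebraMap_mul_invSelf_pow_mem_blowupAlgebra t n hκ
      refine ⟨⟨_, hzmem⟩, Subtype.ext ?_⟩
      rw [hΦval]
      change Φ₀ (algebraMap S (Localization.Away t) κ * Away.invSelf t ^ n) =
        (c : Localization.Away y)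
      rw [map_mul, map_pow, hΦ₀alg, hΦ₀inv, hjκ, ← pow_mul]
      -- `c = r'' / y^{2n}`
      have hinv : algebraMap R (Localization.Away y) (y ^ (2 * n)) * Away.invSelf y ^ (2 * n) = 1 := by
        rw [map_pow, ← mul_pow, Away.mul_invSelf, one_pow]
      calc algebraMap R (Localization.Away y) r'' * Away.invSelf y ^ (2 * n)
          = algebraMap R (Localization.Away y) (y ^ (2 * n)) * c * Away.invSelf y ^ (2 * n) := by
            rw [hcr'']
        _ = c * (algebraMap R (Localization.Away y) (y ^ (2 * n)) * Away.invSelf y ^ (2 * n)) := by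
            ring
        _ = c := by rw [hinv, mul_one]

include hι hj hfix in
/-- **Corollary (any spelling of the fixed subring).** For a subring `F` of the chart ring
`C = R[I_ι/y]` which is exactly the `ιC`-fixed locus, `S[K/t] ≃+* F` over `j` — the form consumed
together with H5 (`F :=` the subring underlying the `FixedPoints` subalgebra of `⟨ιC⟩`).
[OURS · L1 W4.5c, card `mu2-strata-kl-twice` (o1)] [folklore] -/
theorem exists_chartRingEquiv (h2 : IsUnit (2 : R)) {y : R} (hy : ι y = -y) (t : S)
    (ht : j t = y ^ 2) (C : Subalgebra R (Localization.Away y))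
    (hC : C = blowupAlgebra (augIdeal ι) y) (ιC : C ≃+* C)
    (hιC : ∀ r : R, ((ιC (algebraMap R C r) : C) : Localization.Away y) =
      algebraMap R (Localization.Away y) (ι r))
    (F : Subring C) (hF : ∀ c : C, c ∈ F ↔ ιC c = c) :
    ∃ e : blowupAlgebra ((augIdeal ι).comap j) t ≃+* F,
      ∀ s : S, ((((e (algebraMap S (blowupAlgebra ((augIdeal ι).comap j) t) s)) : F) : C) :
          Localization.Away y) = algebraMap R (Localization.Away y) (j s) := by
  obtain ⟨Φ, hinj, halg, hrange⟩ := exists_chartRingHom ι hι j hj hfix h2 hy t ht C hC ιC hιC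
  have hmem : ∀ z, Φ z ∈ F := fun z => (hF _).mpr ((hrange _).mp ⟨z, rfl⟩)
  have hg : Function.Bijective (Φ.codRestrict F hmem) := by
    refine ⟨fun a b hab => hinj (congrArg Subtype.val hab), fun f => ?_⟩
    obtain ⟨z, hz⟩ := (hrange f.1).mpr ((hF _).mp f.2)
    exact ⟨z, Subtype.ext hz⟩
  exact ⟨RingEquiv.ofBijective _ hg, fun s => halg s⟩

end Summit.ResolutionOfSingularities.ResolutionOfSingularities.Theorems.WildQuotientResolution.InvolutionExit

end
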